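import Literature.Analysis.DeBrangesSpaces.ConreyLi2000SpacesFWProofs
import Literature.Analysis.DeBrangesSpaces.SzegoKernelSchurExtension
import Mathlib.Analysis.Complex.Polynomial.Basic
import Mathlib.Analysis.Complex.AbsMax
import Mathlib.Analysis.SpecialFunctions.Integrability.Basic
import HarnessLib

/-!
# Conrey–Li 2000, Theorem 2 (de Branges' positivity theorem for `𝓕(W)`) — PROVED

LABEL (line 1): RH-FREE; the discharge `conreyLi2000_thm2_holds` of the named fact
`Literature.Analysis.DeBrangesSpaces.conreyLi2000_thm2` (de Branges' positivity theorem for the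
spaces `𝓕(W)` in the form of Conrey–Li 2000, Theorem 2), over a GENERAL function `W` with the
positivity condition as HYPOTHESIS. bears_on: B-C/B-P (LADDER-RH §1, COLUMN 6 DBR). WHAT THIS IS
NOT: not progress toward RH — the hypothesis of the theorem FAILS for `W = 1/ξ(1 − iz)` and for
every `W_χ` (Conrey–Li §3–§4; tree barrier `Literature.Barriers.RiemannHypothesis.ConreyLi2000_FW_holds`);
formalising the theorem fixes WHICH inequality would have given `ζ(s) ≠ 0` on `Re s > 1/2`, it does
not move RH; nothing here bears on the truth of RH.

J. B. Conrey, X.-J. Li, *A note on some positivity conditions related to zeta and L-functions*,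
IMRN 2000:18, 929–940 = arXiv:math/9812166, §2, Theorem 2 with its proof (arXiv p. 2 line 99 –
p. 3 line 24; read first-hand in the held text `paper:arxiv-math_9812166`).

## The printed proof and its formalisation

1. "If `F(z) = Σ c_α K(w_α, z)`, then `TF(z) = Σ c_β K(w_β + i, z)`. By assumption, we have
   `Σ c_α c̄_β [K(w_α, w_β+i) + K(w_α+i, w_β)] = 2 Re⟨F, TF⟩ ≥ 0`" — `SpaceF.sum_kernel_mem` (finite
   kernel combinations are members of `𝓕(W)`: the Poisson log-majorant clause for the rational
   function `F/W` is proved by factorising its numerator over `ℂ` and using, root by root, the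
   Poisson integral of `log|t − a|` — tree `integral_log_norm_sub_div` for `Im a < 0`, reflection for
   `Im a > 0`, and `integral_log_norm_sub_div_real` below for real `a`), `SpaceF.kernelShift_sum`
   (`T` on combinations, by additivity/homogeneity of `T`), `SpaceF.inner_sum_kernel_kernelShift`
   (`⟨F, TF⟩ = Σ c_α c̄_β K(w_α, w_β+i)`, by the half-plane Cauchy integral
   `∫_ℝ dx/((x − w̄)(x − v)) = 2πi/(v − w̄)`).
2. "This implies `Re W(z)/W(z+i) ≥ 0` … Let `B = (W − W(·+i))/(W + W(·+i))` … the
   positive-definiteness of `(1 − B(z)B̄(w))/(2πi(w̄ − z − i))`" — `posSemidef_cayley` (the algebra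
   `K(w_α, w_β+i) + K(w_α+i, w_β) = W̄(w_α+i)W(w_β+i)·(φ̄(w_α) + φ(w_β))/(2πi(w̄_α − w_β − i))`,
   `φ = W/W(·+i)`, `φ̄ + φ' = 2(1 − B̄B')/((1 − B̄)(1 − B'))`).
3. "`𝓗` … `P` … `P*` … (2.7) … (2.8) … `|B(w)| ≤ 1` for `Im w > −1/2`" — the tree theorem
   `SzegoSchur.szego_schur_extension` (file `SzegoKernelSchurExtension.lean`).
4. "It follows that `W(z)/W(z+i)` is analytic and has nonnegative real part in the half-plane
   `Im z > −1/2`" — `conreyLi2000_thm2_holds`: `W₁(z) := W(z+i)(1 + B₁(z))/(1 − B₁(z))`, where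
   `B₁ ≠ 1` by the maximum modulus principle, `W₁ = W` on `Im z > 0`, and
   `Re W₁(z)/W₁(z+i) = Re (1+B₁)/(1−B₁) = (1 − |B₁|²)/|1 − B₁|² ≥ 0`.

## References

* [ConreyLi2000] J. B. Conrey, X.-J. Li, IMRN 2000:18, 929–940 = arXiv:math/9812166, §2,
  Theorem 2 and its proof (read: arXiv pp. 2–3).
* [Rudin1987] W. Rudin, *Real and Complex Analysis*, 3rd ed., Thm 17.16 (Poisson integral of
  `log|Q|` for an outer function; half-plane form, tree `PoissonLogModulus.lean`).
-/

noncomputable section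

open scoped Real Topology ComplexConjugate InnerProductSpace
open _root_.Complex _root_.MeasureTheory _root_.Filter _root_.Set _root_.Polynomial

namespace Literature.Analysis.DeBrangesSpaces

/-! ## §1. The Poisson integral of `log|t − a|` for real `a` -/

/-- `‖t − a‖ = |t − a|` for real `t`, `a` (viewed in `ℂ`). [folklore] -/
private theorem norm_ofReal_sub_ofReal (t a : ℝ) : ‖(t : ℂ) - (a : ℂ)‖ = |t - a| := by
  rw [← Complex.ofReal_sub, Complex.norm_real, Real.norm_eq_abs]

/-- **Integrability at a real point**: for real `a` and `y ≠ 0`,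
`t ↦ log|t − a| / ((t − x)² + y²)` is integrable on `ℝ` (logarithmic singularity at `t = a`,
`O(log|t|/t²)` at infinity). [cite: Rudin1987, Thm 17.16 (half-plane form)] -/
theorem integrable_log_norm_sub_div_real (a x : ℝ) {y : ℝ} (hy : y ≠ 0) :
    Integrable fun t : ℝ ↦ Real.log ‖(t : ℂ) - (a : ℂ)‖ / ((t - x) ^ 2 + y ^ 2) := by
  set f : ℝ → ℝ := fun t ↦ Real.log ‖(t : ℂ) - (a : ℂ)‖ / ((t - x) ^ 2 + y ^ 2) with hf
  have hP : ∀ t : ℝ, 0 < (t - x) ^ 2 + y ^ 2 := fun t ↦ by positivity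
  have hfmeas : AEStronglyMeasurable f volume := by
    have : Measurable f :=
      (Real.measurable_log.comp (by fun_prop : Measurable fun t : ℝ ↦ ‖(t : ℂ) - (a : ℂ)‖)).div
        (by fun_prop)
    exact this.aestronglyMeasurable
  set S : Set ℝ := Set.Icc (a - 1) (a + 1) with hS
  -- near `a`: `log` is locally integrable
  have hS_int : IntegrableOn f S volume := by
    have hlog : IntervalIntegrable (fun t : ℝ ↦ Real.log (t - a)) volume (-1 + a) (1 + a) :=
      (intervalIntegral.intervalIntegrable_log' (a := -1) (b := 1)).comp_sub_right a
    have hcont : ContinuousOn (fun t : ℝ ↦ ((t - x) ^ 2 + y ^ 2)⁻¹) (Set.uIcc (-1 + a) (1 + a)) := by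
      refine Continuous.continuousOn ?_
      exact Continuous.inv₀ (by fun_prop) fun t ↦ (hP t).ne'
    have h := hlog.mul_continuousOn hcont
    have hle : -1 + a ≤ 1 + a := by linarith
    rw [intervalIntegrable_iff_integrableOn_Icc_of_le hle] at h
    have hS' : S = Set.Icc (-1 + a) (1 + a) := by rw [hS]; congr 1 <;> ring
    rw [hS']
    refine h.congr_fun (fun t _ ↦ ?_) measurableSet_Icc
    simp only [hf]
    rw [norm_ofReal_sub_ofReal, Real.log_abs, div_eq_mul_inv]
  -- away from `a`: dominated by the integrable `log‖t − (a − i)‖/((t−x)²+y²)` of the tree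
  have hSc_int : IntegrableOn f Sᶜ volume := by
    have ha' : ((a : ℂ) - I).im ≠ 0 := by simp
    have hg := (integrable_log_norm_sub_div ha' x hy).norm.integrableOn (s := Sᶜ)
    refine Integrable.mono' hg hfmeas.restrict ?_
    rw [ae_restrict_iff' (measurableSet_Icc.compl)]
    refine ae_of_all _ fun t (ht : t ∉ S) ↦ ?_
    have ht1 : 1 < |t - a| := by
      rw [hS, Set.mem_Icc, not_and_or, not_le, not_le] at ht
      rcases ht with h | h
      · rw [abs_of_neg (by linarith)]; linarith
      · rw [abs_of_pos (by linarith)]; linarith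
    have hna : ‖(t : ℂ) - (a : ℂ)‖ = |t - a| := norm_ofReal_sub_ofReal t a
    have hle : |t - a| ≤ ‖(t : ℂ) - ((a : ℂ) - I)‖ := by
      have h1 : ‖(t : ℂ) - ((a : ℂ) - I)‖ ^ 2 = (t - a) ^ 2 + 1 := by
        rw [norm_ofReal_sub_sq]; simp
      have h2 : |t - a| ^ 2 ≤ ‖(t : ℂ) - ((a : ℂ) - I)‖ ^ 2 := by rw [h1, sq_abs]; linarith
      exact abs_le_of_sq_le_sq' (by nlinarith [norm_nonneg ((t : ℂ) - ((a : ℂ) - I))]) (norm_nonneg _) |>.2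
    have hlog0 : 0 ≤ Real.log |t - a| := Real.log_nonneg ht1.le
    have hlog1 : Real.log |t - a| ≤ Real.log ‖(t : ℂ) - ((a : ℂ) - I)‖ :=
      Real.log_le_log (by linarith) hle
    simp only [hf]
    rw [Real.norm_eq_abs, Real.norm_eq_abs, abs_div, abs_div, abs_of_pos (hP t), hna,
      abs_of_nonneg hlog0, abs_of_nonneg (hlog0.trans hlog1)]
    exact div_le_div_of_nonneg_right hlog1 (hP t).le
  have h := hS_int.union hSc_int
  rwa [Set.union_compl_self, integrableOn_univ] at h

/-- **The Poisson integral of `log|t − a|` for REAL `a`**: for `z = x + iy`, `y > 0`,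
`∫_ℝ log|t − a| dt/((t − x)² + y²) = (π/y) log|z − a|` — the boundary case of the tree's
`integral_log_norm_sub_div` (`Im a < 0`), obtained from it at `a − i/(n+1)` by monotone convergence
(`|t − a + i/(n+1)|` decreases to `|t − a|`). [cite: Rudin1987, Thm 17.16 (half-plane form)] -/
theorem integral_log_norm_sub_div_real (a x : ℝ) {y : ℝ} (hy : 0 < y) :
    ∫ t : ℝ, Real.log ‖(t : ℂ) - (a : ℂ)‖ / ((t - x) ^ 2 + y ^ 2)
      = π / y * Real.log ‖((x : ℂ) + y * I) - (a : ℂ)‖ := by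
  set z : ℂ := (x : ℂ) + y * I with hz
  -- the approximating points `aₙ = a − i/(n+1)`
  set an : ℕ → ℂ := fun n ↦ (a : ℂ) - ((1 / ((n : ℝ) + 1) : ℝ) : ℂ) * I with han
  have han_im : ∀ n, (an n).im = -(1 / ((n : ℝ) + 1)) := fun n ↦ by
    simp only [han, Complex.sub_im, Complex.ofReal_im, Complex.mul_im, Complex.ofReal_re,
      Complex.I_im, Complex.I_re, mul_one, mul_zero, add_zero, zero_sub]
  have han_re : ∀ n, (an n).re = a := fun n ↦ by
    simp only [han, Complex.sub_re, Complex.ofReal_re, Complex.mul_re, Complex.ofReal_im,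
      Complex.I_re, Complex.I_im, mul_zero, mul_one, sub_zero]
  have han_neg : ∀ n, (an n).im < 0 := fun n ↦ by
    rw [han_im, neg_lt_zero]; positivity
  have hP : ∀ t : ℝ, 0 < (t - x) ^ 2 + y ^ 2 := fun t ↦ by positivity
  set f : ℕ → ℝ → ℝ := fun n t ↦ Real.log ‖(t : ℂ) - an n‖ / ((t - x) ^ 2 + y ^ 2) with hf
  set F : ℝ → ℝ := fun t ↦ Real.log ‖(t : ℂ) - (a : ℂ)‖ / ((t - x) ^ 2 + y ^ 2) with hF
  have hfn : ∀ n, Integrable (f n) := fun n ↦ integrable_log_norm_sub_div (han_neg n).ne x hy.ne'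
  have hFi : Integrable F := integrable_log_norm_sub_div_real a x hy.ne'
  -- the norms `‖t − aₙ‖`
  have hnorm_sq : ∀ (n : ℕ) (t : ℝ), ‖(t : ℂ) - an n‖ ^ 2 = (t - a) ^ 2 + (1 / ((n : ℝ) + 1)) ^ 2 := by
    intro n t; rw [norm_ofReal_sub_sq, han_re, han_im, neg_sq]
  have hnorm_pos : ∀ (n : ℕ) (t : ℝ), 0 < ‖(t : ℂ) - an n‖ := by
    intro n t
    refine norm_pos_iff.2 (sub_ne_zero.2 fun h ↦ ?_)
    have h1 := congrArg Complex.im h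
    rw [Complex.ofReal_im, han_im] at h1
    have h2 : (0 : ℝ) < 1 / ((n : ℝ) + 1) := by positivity
    linarith
  -- antitone in `n`
  have h_anti : ∀ᵐ t ∂volume, Antitone fun n ↦ f n t := by
    refine ae_of_all _ fun t ↦ antitone_nat_of_succ_le fun n ↦ ?_
    simp only [hf]
    refine div_le_div_of_nonneg_right (Real.log_le_log (hnorm_pos _ t) ?_) (hP t).le
    have h1 : ‖(t : ℂ) - an (n + 1)‖ ^ 2 ≤ ‖(t : ℂ) - an n‖ ^ 2 := by
      rw [hnorm_sq, hnorm_sq]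
      have h3 : 1 / (((n + 1 : ℕ) : ℝ) + 1) ≤ 1 / ((n : ℝ) + 1) := by
        push_cast
        exact one_div_le_one_div_of_le (by positivity) (by linarith)
      have : (1 / (((n + 1 : ℕ) : ℝ) + 1)) ^ 2 ≤ (1 / ((n : ℝ) + 1)) ^ 2 :=
        pow_le_pow_left₀ (by positivity) h3 2
      linarith
    exact (pow_le_pow_iff_left₀ (norm_nonneg _) (norm_nonneg _) two_ne_zero).1 h1
  -- convergence `aₙ → a`
  have han_tendsto : Tendsto an atTop (𝓝 (a : ℂ)) := by
    have h1 : Tendsto (fun n : ℕ ↦ (((1 / ((n : ℝ) + 1) : ℝ) : ℂ))) atTop (𝓝 ((0 : ℝ) : ℂ)) :=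
      (Complex.continuous_ofReal.tendsto 0).comp tendsto_one_div_add_atTop_nhds_zero_nat
    have h2 : Tendsto (fun n : ℕ ↦ (a : ℂ) - (((1 / ((n : ℝ) + 1) : ℝ) : ℂ)) * I) atTop
        (𝓝 ((a : ℂ) - ((0 : ℝ) : ℂ) * I)) := (h1.mul_const I).const_sub _
    have h3 : (a : ℂ) - ((0 : ℝ) : ℂ) * I = (a : ℂ) := by simp
    rw [h3] at h2
    exact h2
  -- pointwise convergence off `t = a`
  have h_tendsto : ∀ᵐ t ∂volume, Tendsto (fun n ↦ f n t) atTop (𝓝 (F t)) := by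
    have hae : ∀ᵐ t ∂(volume : Measure ℝ), t ≠ a := by
      have : ({a}ᶜ : Set ℝ) ∈ ae (volume : Measure ℝ) := compl_mem_ae_iff.2 (measure_singleton a)
      filter_upwards [this] with t ht
      exact ht
    filter_upwards [hae] with t hta
    simp only [hf, hF]
    have hne : ‖(t : ℂ) - (a : ℂ)‖ ≠ 0 := by
      rw [norm_ofReal_sub_ofReal]; exact abs_ne_zero.2 (sub_ne_zero.2 hta)
    have h1 : Tendsto (fun n ↦ ‖(t : ℂ) - an n‖) atTop (𝓝 ‖(t : ℂ) - (a : ℂ)‖) :=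
      (tendsto_const_nhds.sub han_tendsto).norm
    exact ((Real.continuousAt_log hne).tendsto.comp h1).div_const _
  have hlim := integral_tendsto_of_tendsto_of_antitone hfn hFi h_anti h_tendsto
  -- the integrals `∫ fₙ = (π/y) log‖z − aₙ‖ → (π/y) log‖z − a‖`
  have hint_n : ∀ n, ∫ t, f n t = π / y * Real.log ‖z - an n‖ := fun n ↦
    integral_log_norm_sub_div (han_neg n) x hy
  have hza : ‖z - (a : ℂ)‖ ≠ 0 := by
    refine norm_ne_zero_iff.2 fun h ↦ ?_
    have := congrArg Complex.im h
    simp [hz] at this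
    exact hy.ne' this
  have hlim2 : Tendsto (fun n ↦ ∫ t, f n t) atTop (𝓝 (π / y * Real.log ‖z - (a : ℂ)‖)) := by
    simp_rw [hint_n]
    have h1 : Tendsto (fun n ↦ ‖z - an n‖) atTop (𝓝 ‖z - (a : ℂ)‖) :=
      (tendsto_const_nhds.sub han_tendsto).norm
    exact (((Real.continuousAt_log hza).tendsto.comp h1).const_mul _)
  exact tendsto_nhds_unique hlim hlim2

/-- **The Poisson majorant of `log|· − a|` for an ARBITRARY complex `a`**: for `z = x + iy` in the
upper half-plane with `z ≠ a`, `t ↦ log|t − a|/((t−x)²+y²)` is integrable and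
`log|z − a| ≤ (y/π) ∫_ℝ log|t − a| dt/((t − x)² + y²)` — equality for `Im a ≤ 0` (tree
`integral_log_norm_sub_div`, and `integral_log_norm_sub_div_real`), and for `Im a > 0` the
right side is `log|z − ā| ≥ log|z − a|` (`|t − a| = |t − ā|` on `ℝ`). This is the subharmonicity of
`log|z − a|` in the form needed for Conrey–Li's membership inequality.
[cite: Rudin1987, Thm 17.16 (half-plane form)] -/
theorem log_norm_sub_le_poisson (a : ℂ) (x : ℝ) {y : ℝ} (hy : 0 < y)
    (hza : (x : ℂ) + y * I ≠ a) :
    Integrable (fun t : ℝ ↦ Real.log ‖(t : ℂ) - a‖ / ((t - x) ^ 2 + y ^ 2)) ∧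
      Real.log ‖((x : ℂ) + y * I) - a‖
        ≤ y / π * ∫ t : ℝ, Real.log ‖(t : ℂ) - a‖ / ((t - x) ^ 2 + y ^ 2) := by
  have hyπ : y / π * (π / y) = 1 := by field_simp
  rcases lt_trichotomy a.im 0 with him | him | him
  · refine ⟨integrable_log_norm_sub_div him.ne x hy.ne', le_of_eq ?_⟩
    rw [integral_log_norm_sub_div him x hy, ← mul_assoc, hyπ, one_mul]
  · have ha : a = (a.re : ℂ) := Complex.ext (by simp) (by simp [him])
    rw [ha]
    refine ⟨integrable_log_norm_sub_div_real a.re x hy.ne', le_of_eq ?_⟩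
    rw [integral_log_norm_sub_div_real a.re x hy, ← mul_assoc, hyπ, one_mul]
  · have hconj : ∀ t : ℝ, ‖(t : ℂ) - a‖ = ‖(t : ℂ) - conj a‖ := by
      intro t
      have h1 := norm_ofReal_sub_sq t a
      have h2 := norm_ofReal_sub_sq t (conj a)
      rw [Complex.conj_re, Complex.conj_im, neg_sq] at h2
      exact (pow_left_inj₀ (norm_nonneg _) (norm_nonneg _) two_ne_zero).1 (h1.trans h2.symm)
    have hca : (conj a).im < 0 := by rw [Complex.conj_im]; linarith
    simp_rw [hconj]
    refine ⟨integrable_log_norm_sub_div hca.ne x hy.ne', ?_⟩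
    rw [integral_log_norm_sub_div hca x hy, ← mul_assoc, hyπ, one_mul]
    refine Real.log_le_log (norm_pos_iff.2 (sub_ne_zero.2 hza)) ?_
    have h1 : ‖((x : ℂ) + y * I) - a‖ ^ 2 = (x - a.re) ^ 2 + (y - a.im) ^ 2 := by
      rw [← Complex.normSq_eq_norm_sq, Complex.normSq_apply]; simp; ring
    have h2 : ‖((x : ℂ) + y * I) - conj a‖ ^ 2 = (x - a.re) ^ 2 + (y + a.im) ^ 2 := by
      rw [← Complex.normSq_eq_norm_sq, Complex.normSq_apply]; simp; ring
    have h3 : ‖((x : ℂ) + y * I) - a‖ ^ 2 ≤ ‖((x : ℂ) + y * I) - conj a‖ ^ 2 := by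
      rw [h1, h2]; nlinarith
    exact (pow_le_pow_iff_left₀ (norm_nonneg _) (norm_nonneg _) two_ne_zero).1 h3

/-- Integrability of `t ↦ log|t − a|/((t−x)²+y²)` for every complex `a` and `y ≠ 0` (tree lemma
for `Im a ≠ 0`, `integrable_log_norm_sub_div_real` for real `a`).
[cite: Rudin1987, Thm 17.16 (half-plane form)] -/
theorem integrable_log_norm_sub_div' (a : ℂ) (x : ℝ) {y : ℝ} (hy : y ≠ 0) :
    Integrable fun t : ℝ ↦ Real.log ‖(t : ℂ) - a‖ / ((t - x) ^ 2 + y ^ 2) := by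
  by_cases him : a.im = 0
  · have ha : a = (a.re : ℂ) := Complex.ext (by simp) (by simp [him])
    rw [ha]
    exact integrable_log_norm_sub_div_real a.re x hy
  · exact integrable_log_norm_sub_div him x hy

namespace SpaceF

variable {W : ℂ → ℂ}

/-! ## §2. Finite combinations of kernels are members of `𝓕(W)` -/

/-- For `Im w > 0` and `Im z ≥ 0`: `2πi(w̄ − z) ≠ 0`. [folklore] -/
private theorem den_ne_zero' {w : ℂ} (hw : 0 < w.im) {z : ℂ} (hz : 0 ≤ z.im) :
    2 * (π : ℂ) * I * (conj w - z) ≠ 0 := by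
  have h1 : conj w - z ≠ 0 := by
    intro h
    have := congrArg Complex.im h
    simp only [sub_im, conj_im, zero_im] at this
    linarith
  exact mul_ne_zero (mul_ne_zero (mul_ne_zero two_ne_zero (ofReal_ne_zero.2 Real.pi_ne_zero))
    I_ne_zero) h1

/-- `‖2πi(w̄ − z)‖ = 2π ‖z − w̄‖`. [folklore] -/
private theorem norm_den' (w z : ℂ) :
    ‖2 * (π : ℂ) * I * (conj w - z)‖ = 2 * π * ‖z - conj w‖ := by
  rw [norm_mul, norm_mul, norm_mul, Complex.norm_I, mul_one, Complex.norm_real,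
    Real.norm_eq_abs, abs_of_pos Real.pi_pos, Complex.norm_two, norm_sub_rev]

/-- `‖c/(2πi(w̄ − z))‖ ≤ ‖c‖/(2π Im w)` on the closed upper half-plane. [folklore] -/
private theorem norm_q_le' {w : ℂ} (hw : 0 < w.im) (c : ℂ) {z : ℂ} (hz : 0 ≤ z.im) :
    ‖c / (2 * π * I * (conj w - z))‖ ≤ ‖c‖ / (2 * π * w.im) := by
  rw [norm_div, norm_den']
  have him : w.im ≤ ‖z - conj w‖ := by
    have h := Complex.abs_im_le_norm (z - conj w)
    have h2 : (z - conj w).im = z.im + w.im := by simp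
    rw [h2, abs_of_pos (by linarith)] at h
    linarith
  exact div_le_div_of_nonneg_left (norm_nonneg _) (by positivity) (by nlinarith [Real.pi_pos])

/-- `F/W` for a finite combination `F = Σ cᵢ K(wᵢ, ·)` of kernels: where `W(z) ≠ 0`,
`F(z)/W(z) = Σ cᵢ conj W(wᵢ) / (2πi(w̄ᵢ − z))` (a rational function of `z`).
[cite: ConreyLi2000, proof of Theorem 2 (first display)] -/
theorem sum_kernel_div {ι : Type*} (s : Finset ι) (w c : ι → ℂ) {z : ℂ} (hz : W z ≠ 0) :
    (∑ i ∈ s, c i * kernel W (w i) z) / W z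
      = ∑ i ∈ s, c i * conj (W (w i)) / (2 * π * I * (conj (w i) - z)) := by
  rw [Finset.sum_div]
  refine Finset.sum_congr rfl fun i _ ↦ ?_
  rw [mul_div_assoc, kernel_div_eq W (w i) hz, ← mul_div_assoc]

/-- The rational function `Σ cᵢ conj W(wᵢ)/(2πi(w̄ᵢ − z))` is continuous at every point of the
closed upper half-plane (its poles `w̄ᵢ` lie in the lower half-plane). [folklore] -/
private theorem continuousAt_sum_q {ι : Type*} (s : Finset ι) (w c : ι → ℂ)
    (hw : ∀ i ∈ s, 0 < (w i).im) {z : ℂ} (hz : 0 ≤ z.im) :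
    ContinuousAt (fun z ↦ ∑ i ∈ s, c i * conj (W (w i)) / (2 * π * I * (conj (w i) - z))) z := by
  refine tendsto_finsetSum s fun i hi ↦ ?_
  have h1 : ContinuousAt (fun _ : ℂ ↦ c i * conj (W (w i))) z := continuousAt_const
  have h2 : ContinuousAt (fun u : ℂ ↦ 2 * (π : ℂ) * I * (conj (w i) - u)) z :=
    (by fun_prop : Continuous fun u : ℂ ↦ 2 * (π : ℂ) * I * (conj (w i) - u)).continuousAt
  exact (h1.div h2 (den_ne_zero' (hw i hi) hz)).tendsto

/-- **Boundary values through a continuous representative**: if `G/W = R` on the open upper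
half-plane and `R` is continuous at the real point `x`, then the vertical limit of `G/W` at `x`
exists and `bdryValue (G/W) x = R x`. [cite: ConreyLi2000, §2 (definition of 𝓕(W): boundary values)] -/
theorem bdryValue_eq_of_eqOn_of_continuousAt {G R : ℂ → ℂ}
    (hG : ∀ z : ℂ, 0 < z.im → G z / W z = R z) {x : ℝ} (hR : ContinuousAt R x) :
    Tendsto (fun y : ℝ ↦ G ((x : ℂ) + y * I) / W ((x : ℂ) + y * I)) (𝓝[>] (0 : ℝ)) (𝓝 (R x)) ∧
      bdryValue (fun z ↦ G z / W z) x = R x := by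
  have hpath : Tendsto (fun y : ℝ ↦ (x : ℂ) + y * I) (𝓝[>] (0 : ℝ)) (𝓝 (x : ℂ)) := by
    have hc : Continuous fun y : ℝ ↦ (x : ℂ) + y * I := by fun_prop
    have h1 : Tendsto (fun y : ℝ ↦ (x : ℂ) + y * I) (𝓝 (0 : ℝ)) (𝓝 (x : ℂ)) := by
      simpa using hc.tendsto 0
    exact h1.mono_left nhdsWithin_le_nhds
  have ht : Tendsto (fun y : ℝ ↦ R ((x : ℂ) + y * I)) (𝓝[>] (0 : ℝ)) (𝓝 (R x)) :=
    hR.tendsto.comp hpath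
  have hev : (fun y : ℝ ↦ R ((x : ℂ) + y * I))
      =ᶠ[𝓝[>] (0 : ℝ)] fun y : ℝ ↦ G ((x : ℂ) + y * I) / W ((x : ℂ) + y * I) := by
    filter_upwards [self_mem_nhdsWithin] with y hy
    exact (hG _ (by simpa using hy)).symm
  have ht' := ht.congr' hev
  exact ⟨ht', bdryValue_eq_of_tendsto ht'⟩

/-- The boundary function `Σ cᵢ conj W(wᵢ)/(2πi(w̄ᵢ − x))` is in `L²(ℝ)`. [folklore] -/
private theorem memLp_sum_q {ι : Type*} (s : Finset ι) (w c : ι → ℂ)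
    (hw : ∀ i ∈ s, 0 < (w i).im) :
    MemLp (fun x : ℝ ↦ ∑ i ∈ s, c i * conj (W (w i)) / (2 * π * I * (conj (w i) - x))) 2 volume := by
  refine memLp_finsetSum s fun i hi ↦ ?_
  set C : ℂ := c i * conj (W (w i)) with hC
  have hwi := hw i hi
  have hcont : Continuous fun x : ℝ ↦ C / (2 * π * I * (conj (w i) - x)) :=
    Continuous.div continuous_const (by fun_prop) fun x ↦ den_ne_zero' hwi (by simp)
  rw [memLp_two_iff_integrable_sq_norm hcont.aestronglyMeasurable]
  have hint := (integrable_inv_sub_sq_add_sq (w i).re hwi.ne').const_mul ((‖C‖ / (2 * π)) ^ 2)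
  refine hint.congr (ae_of_all _ fun x ↦ ?_)
  simp only
  rw [norm_div, norm_den']
  simp only [div_pow, mul_pow]
  rw [norm_ofReal_sub_sq, conj_re, conj_im, neg_sq]
  have h0 : (x - (w i).re) ^ 2 + (w i).im ^ 2 ≠ 0 := by positivity
  field_simp

/-- **The Poisson log-majorant of a rational function with poles in the lower half-plane.**
For `R(z) = Σ cᵢ conj W(wᵢ)/(2πi(w̄ᵢ − z))` (`Im wᵢ > 0`) and `z = x + iy`, `y > 0`:
`t ↦ log|R(t)|/((t−x)²+y²)` is integrable, and if `R(z) ≠ 0` then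
`log|R(z)| ≤ (y/π)∫ log|R(t)| dt/((t−x)²+y²)`. Proof: write `R = p/q` with
`q = Π (w̄ᵢ − X)`; if `p = 0` all is trivial; otherwise factor `p = c Π (X − a)^{k_a}` over `ℂ`,
so `log|R| = log|c| + Σ k_a log|· − a| − Σᵢ log|· − w̄ᵢ|` off the (finitely many) zeros, and apply
the Poisson integral of `log|t − a|` root by root (`log_norm_sub_le_poisson`, equality for the
`w̄ᵢ`). [cite: ConreyLi2000, §2 (definition of 𝓕(W): the membership inequality)] -/
theorem poissonLogMajorant_sum_q {ι : Type*} (s : Finset ι) (w c : ι → ℂ)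
    (hw : ∀ i ∈ s, 0 < (w i).im) (x : ℝ) {y : ℝ} (hy : 0 < y) :
    Integrable (fun t : ℝ ↦ Real.log ‖∑ i ∈ s, c i * conj (W (w i)) / (2 * π * I * (conj (w i) - t))‖
        / ((t - x) ^ 2 + y ^ 2)) ∧
      ((∑ i ∈ s, c i * conj (W (w i)) / (2 * π * I * (conj (w i) - ((x : ℂ) + y * I)))) ≠ 0 →
        Real.log ‖∑ i ∈ s, c i * conj (W (w i)) / (2 * π * I * (conj (w i) - ((x : ℂ) + y * I)))‖
          ≤ y / π * ∫ t : ℝ, Real.log ‖∑ i ∈ s, c i * conj (W (w i)) / (2 * π * I * (conj (w i) - t))‖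
            / ((t - x) ^ 2 + y ^ 2)) := by
  classical
  set z : ℂ := (x : ℂ) + y * I with hz
  have hzim : z.im = y := by simp [hz]
  set R : ℂ → ℂ := fun u ↦ ∑ i ∈ s, c i * conj (W (w i)) / (2 * π * I * (conj (w i) - u)) with hR
  set P : ℝ → ℝ := fun t ↦ (t - x) ^ 2 + y ^ 2 with hP
  have hP0 : ∀ t, 0 < P t := fun t ↦ by simp only [hP]; positivity
  change Integrable (fun t : ℝ ↦ Real.log ‖R t‖ / P t) ∧
    (R z ≠ 0 → Real.log ‖R z‖ ≤ y / π * ∫ t : ℝ, Real.log ‖R t‖ / P t)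
  -- the polynomials `p`, `q`
  set A : ι → ℂ := fun i ↦ c i * conj (W (w i)) / (2 * π * I) with hA
  set q : ℂ[X] := ∏ i ∈ s, (Polynomial.C (conj (w i)) - Polynomial.X) with hq
  set p : ℂ[X] := ∑ i ∈ s, Polynomial.C (A i) *
    ∏ j ∈ s.erase i, (Polynomial.C (conj (w j)) - Polynomial.X) with hp
  have hq_eval : ∀ u : ℂ, q.eval u = ∏ i ∈ s, (conj (w i) - u) := by
    intro u; simp [hq, Polynomial.eval_prod]
  have hp_eval : ∀ u : ℂ, p.eval u = ∑ i ∈ s, A i * ∏ j ∈ s.erase i, (conj (w j) - u) := by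
    intro u; simp [hp, Polynomial.eval_finsetSum, Polynomial.eval_prod]
  have hfac_ne : ∀ u : ℂ, 0 ≤ u.im → ∀ i ∈ s, conj (w i) - u ≠ 0 := by
    intro u hu i hi h
    have := congrArg Complex.im h
    simp only [sub_im, conj_im, zero_im] at this
    linarith [hw i hi]
  have hq_ne : ∀ u : ℂ, 0 ≤ u.im → q.eval u ≠ 0 := fun u hu ↦ by
    rw [hq_eval]; exact Finset.prod_ne_zero_iff.2 (hfac_ne u hu)
  have hRpq : ∀ u : ℂ, 0 ≤ u.im → R u = p.eval u / q.eval u := by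
    intro u hu
    rw [eq_div_iff (hq_ne u hu), hp_eval, hq_eval, hR]
    simp only
    rw [Finset.sum_mul]
    refine Finset.sum_congr rfl fun i hi ↦ ?_
    rw [← Finset.mul_prod_erase s (fun j ↦ conj (w j) - u) hi]
    have hi0 : conj (w i) - u ≠ 0 := hfac_ne u hu i hi
    have h2πI : 2 * (π : ℂ) * I ≠ 0 :=
      mul_ne_zero (mul_ne_zero two_ne_zero (ofReal_ne_zero.2 Real.pi_ne_zero)) I_ne_zero
    simp only [hA]
    field_simp
  -- real points and `z` lie in the closed upper half-plane
  have hreal : ∀ t : ℝ, (0 : ℝ) ≤ ((t : ℂ)).im := fun t ↦ by simp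
  have hzge : 0 ≤ z.im := by rw [hzim]; exact hy.le
  by_cases hp0 : p = 0
  · -- `R ≡ 0` on the closed upper half-plane
    have hR0 : ∀ u : ℂ, 0 ≤ u.im → R u = 0 := fun u hu ↦ by
      rw [hRpq u hu, hp0, Polynomial.eval_zero, zero_div]
    refine ⟨?_, fun hne ↦ absurd (hR0 z hzge) hne⟩
    have : (fun t : ℝ ↦ Real.log ‖R t‖ / P t) = fun _ ↦ 0 := by
      funext t; rw [hR0 t (hreal t), norm_zero, Real.log_zero, zero_div]
    rw [this]; exact integrable_zero _ _ _
  -- `p ≠ 0`: factor over `ℂ`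
  set lc : ℂ := p.leadingCoeff with hlc
  have hlc0 : lc ≠ 0 := Polynomial.leadingCoeff_ne_zero.2 hp0
  set T : Finset ℂ := p.roots.toFinset with hT
  set k : ℂ → ℕ := fun a ↦ p.roots.count a with hk
  have hp_eval' : ∀ u : ℂ, p.eval u = lc * ∏ a ∈ T, (u - a) ^ k a := by
    intro u
    have hsplit := (IsAlgClosed.splits p).eq_prod_roots
    conv_lhs => rw [hsplit]
    rw [Polynomial.eval_mul, Polynomial.eval_C, Polynomial.eval_multiset_prod, Multiset.map_map]
    have : ((fun r : ℂ[X] ↦ Polynomial.eval u r) ∘ fun a : ℂ ↦ Polynomial.X - Polynomial.C a)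
        = fun a ↦ u - a := by
      funext a; simp
    rw [this, Finset.prod_multiset_map_count]
  have hk_pos : ∀ a ∈ T, 0 < k a := fun a ha ↦ by
    rw [hk]; exact Multiset.count_pos.2 (Multiset.mem_toFinset.1 ha)
  -- where `p` does not vanish, no root factor vanishes, and `log|p|` splits
  have hroot_ne : ∀ u : ℂ, p.eval u ≠ 0 → ∀ a ∈ T, u - a ≠ 0 := by
    intro u hu a ha h
    apply hu
    rw [hp_eval']
    refine mul_eq_zero_of_right _ (Finset.prod_eq_zero ha ?_)
    rw [h, zero_pow (hk_pos a ha).ne']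
  have hlogp : ∀ u : ℂ, p.eval u ≠ 0 →
      Real.log ‖p.eval u‖ = Real.log ‖lc‖ + ∑ a ∈ T, (k a : ℝ) * Real.log ‖u - a‖ := by
    intro u hu
    rw [hp_eval', norm_mul, norm_prod, Real.log_mul (norm_ne_zero_iff.2 hlc0)
      (Finset.prod_ne_zero_iff.2 fun a ha ↦ by
        rw [norm_pow]; exact pow_ne_zero _ (norm_ne_zero_iff.2 (hroot_ne u hu a ha))),
      Real.log_prod (fun a ha ↦ by
        rw [norm_pow]; exact pow_ne_zero _ (norm_ne_zero_iff.2 (hroot_ne u hu a ha)))]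
    refine congrArg _ (Finset.sum_congr rfl fun a _ ↦ ?_)
    rw [norm_pow, Real.log_pow]
  have hlogq : ∀ u : ℂ, 0 ≤ u.im →
      Real.log ‖q.eval u‖ = ∑ i ∈ s, Real.log ‖u - conj (w i)‖ := by
    intro u hu
    rw [hq_eval, norm_prod, Real.log_prod (fun i hi ↦ norm_ne_zero_iff.2 (hfac_ne u hu i hi))]
    refine Finset.sum_congr rfl fun i _ ↦ ?_
    rw [norm_sub_rev]
  have hlogR : ∀ u : ℂ, 0 ≤ u.im → p.eval u ≠ 0 →
      Real.log ‖R u‖ = Real.log ‖lc‖ + ∑ a ∈ T, (k a : ℝ) * Real.log ‖u - a‖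
        - ∑ i ∈ s, Real.log ‖u - conj (w i)‖ := by
    intro u hu hpu
    rw [hRpq u hu, norm_div, Real.log_div (norm_ne_zero_iff.2 hpu) (norm_ne_zero_iff.2 (hq_ne u hu)),
      hlogp u hpu, hlogq u hu]
  -- the expanded integrand
  set Φ : ℝ → ℝ := fun t ↦ Real.log ‖lc‖ * (P t)⁻¹
    + ∑ a ∈ T, (k a : ℝ) * (Real.log ‖(t : ℂ) - a‖ / P t)
    - ∑ i ∈ s, Real.log ‖(t : ℂ) - conj (w i)‖ / P t with hΦ
  have hΦ_eq : ∀ t : ℝ, p.eval (t : ℂ) ≠ 0 → Real.log ‖R t‖ / P t = Φ t := by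
    intro t ht
    rw [hlogR (t : ℂ) (hreal t) ht, hΦ]
    simp only
    rw [sub_div, add_div, div_eq_mul_inv (Real.log ‖lc‖), Finset.sum_div, Finset.sum_div]
    congr 2
    refine Finset.sum_congr rfl fun a _ ↦ ?_
    rw [mul_div_assoc]
  -- `p(t) ≠ 0` for almost every real `t`
  have hae : ∀ᵐ t : ℝ ∂volume, p.eval (t : ℂ) ≠ 0 := by
    have hfin : (Complex.ofReal ⁻¹' (T : Set ℂ)).Finite :=
      T.finite_toSet.preimage Complex.ofReal_injective.injOn
    have hnull := hfin.measure_zero (volume : Measure ℝ)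
    rw [← compl_mem_ae_iff] at hnull
    filter_upwards [hnull] with t ht
    intro h0
    apply ht
    change (t : ℂ) ∈ (T : Set ℂ)
    rw [Finset.mem_coe, hT, Multiset.mem_toFinset, Polynomial.mem_roots hp0]
    exact h0
  -- integrability of each piece
  have hint_const : Integrable fun t : ℝ ↦ Real.log ‖lc‖ * (P t)⁻¹ :=
    (integrable_inv_sub_sq_add_sq x hy.ne').const_mul _
  have hint_root : ∀ a ∈ T, Integrable fun t : ℝ ↦ (k a : ℝ) * (Real.log ‖(t : ℂ) - a‖ / P t) :=
    fun a _ ↦ (integrable_log_norm_sub_div' a x hy.ne').const_mul _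
  have hint_roots : Integrable fun t : ℝ ↦ ∑ a ∈ T, (k a : ℝ) * (Real.log ‖(t : ℂ) - a‖ / P t) :=
    integrable_finsetSum T hint_root
  have hconj_im : ∀ i ∈ s, (conj (w i)).im ≠ 0 := fun i hi ↦ by
    rw [conj_im]; linarith [hw i hi]
  have hint_pole : ∀ i ∈ s, Integrable fun t : ℝ ↦ Real.log ‖(t : ℂ) - conj (w i)‖ / P t :=
    fun i hi ↦ integrable_log_norm_sub_div (hconj_im i hi) x hy.ne'
  have hint_poles : Integrable fun t : ℝ ↦ ∑ i ∈ s, Real.log ‖(t : ℂ) - conj (w i)‖ / P t :=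
    integrable_finsetSum s hint_pole
  have hΦint : Integrable Φ := (hint_const.add hint_roots).sub hint_poles
  have haeq : (fun t : ℝ ↦ Real.log ‖R t‖ / P t) =ᵐ[volume] Φ := by
    filter_upwards [hae] with t ht
    exact hΦ_eq t ht
  refine ⟨hΦint.congr haeq.symm, fun hRz ↦ ?_⟩
  -- the inequality
  have hpz : p.eval z ≠ 0 := by
    intro h0; apply hRz; rw [hRpq z hzge, h0, zero_div]
  rw [integral_congr_ae haeq]
  have hint_sum : Integrable fun t : ℝ ↦ Real.log ‖lc‖ * (P t)⁻¹
      + ∑ a ∈ T, (k a : ℝ) * (Real.log ‖(t : ℂ) - a‖ / P t) := hint_const.add hint_roots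
  have hΦ_int_eq : ∫ t, Φ t = Real.log ‖lc‖ * (π / y)
      + ∑ a ∈ T, (k a : ℝ) * (∫ t : ℝ, Real.log ‖(t : ℂ) - a‖ / P t)
      - ∑ i ∈ s, (∫ t : ℝ, Real.log ‖(t : ℂ) - conj (w i)‖ / P t) := by
    change ∫ t : ℝ, (Real.log ‖lc‖ * (P t)⁻¹
      + ∑ a ∈ T, (k a : ℝ) * (Real.log ‖(t : ℂ) - a‖ / P t)
      - ∑ i ∈ s, Real.log ‖(t : ℂ) - conj (w i)‖ / P t) = _
    rw [integral_sub hint_sum hint_poles, integral_add hint_const hint_roots,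
      integral_const_mul, integral_finsetSum T hint_root, integral_finsetSum s hint_pole]
    have hPinv : ∫ t : ℝ, (P t)⁻¹ = π / y := integral_inv_sub_sq_add_sq x hy
    rw [hPinv]
    congr 2
    refine Finset.sum_congr rfl fun a _ ↦ ?_
    exact integral_const_mul _ _
  rw [hΦ_int_eq, hlogR z hzge hpz]
  -- compare termwise
  have hyπ : y / π * (π / y) = 1 := by field_simp
  have hroots_le : ∑ a ∈ T, (k a : ℝ) * Real.log ‖z - a‖
      ≤ y / π * ∑ a ∈ T, (k a : ℝ) * (∫ t : ℝ, Real.log ‖(t : ℂ) - a‖ / P t) := by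
    rw [Finset.mul_sum]
    refine Finset.sum_le_sum fun a ha ↦ ?_
    have hza : z ≠ a := sub_ne_zero.1 (hroot_ne z hpz a ha)
    have h := (log_norm_sub_le_poisson a x hy hza).2
    rw [← hz] at h
    calc (k a : ℝ) * Real.log ‖z - a‖
        ≤ (k a : ℝ) * (y / π * ∫ t : ℝ, Real.log ‖(t : ℂ) - a‖ / P t) :=
          mul_le_mul_of_nonneg_left h (Nat.cast_nonneg _)
      _ = y / π * ((k a : ℝ) * ∫ t : ℝ, Real.log ‖(t : ℂ) - a‖ / P t) := by ring
  have hpoles_eq : ∑ i ∈ s, Real.log ‖z - conj (w i)‖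
      = y / π * ∑ i ∈ s, (∫ t : ℝ, Real.log ‖(t : ℂ) - conj (w i)‖ / P t) := by
    rw [Finset.mul_sum]
    refine Finset.sum_congr rfl fun i hi ↦ ?_
    have hci : (conj (w i)).im < 0 := by rw [conj_im]; linarith [hw i hi]
    rw [integral_log_norm_sub_div hci x hy, ← mul_assoc, hyπ, one_mul]
  have hconst : Real.log ‖lc‖ = y / π * (Real.log ‖lc‖ * (π / y)) := by
    rw [mul_comm (Real.log ‖lc‖), ← mul_assoc, hyπ, one_mul]
  rw [mul_sub, mul_add]
  linarith

/-- **Finite combinations of kernels are members of `𝓕(W)`** ("If `F(z) = Σ c_α K(w_α, z)` …"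
— the elements of `𝓕(W)` to which the printed proof applies the hypothesis `Re⟨F, TF⟩ ≥ 0`): for `W`
analytic and zero-free on the open upper half-plane and points `wᵢ` there, `F = Σ cᵢ K(wᵢ, ·)`
satisfies Conrey–Li's membership conditions — `F/W = Σ cᵢ conj W(wᵢ)/(2πi(w̄ᵢ − z))` is bounded and
analytic (bounded type over `1`), its boundary function is the same rational function on `ℝ`
(square integrable), and the Poisson log-majorant inequality holds (`poissonLogMajorant_sum_q`).
[cite: ConreyLi2000, Theorem 2 (proof, first display) and §2 (definition of 𝓕(W))] -/
theorem sum_kernel_mem (hW : DifferentiableOn ℂ W {z : ℂ | 0 < z.im})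
    (hW0 : ∀ z : ℂ, 0 < z.im → W z ≠ 0) {ι : Type*} (s : Finset ι) (w c : ι → ℂ)
    (hw : ∀ i ∈ s, 0 < (w i).im) :
    Mem W (fun z ↦ ∑ i ∈ s, c i * kernel W (w i) z) := by
  set R : ℂ → ℂ := fun u ↦ ∑ i ∈ s, c i * conj (W (w i)) / (2 * π * I * (conj (w i) - u)) with hR
  have hq : ∀ z : ℂ, 0 < z.im → (∑ i ∈ s, c i * kernel W (w i) z) / W z = R z :=
    fun z hz ↦ sum_kernel_div s w c (hW0 z hz)
  have hbv : ∀ x : ℝ, bdryValue (fun z ↦ (∑ i ∈ s, c i * kernel W (w i) z) / W z) x = R x :=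
    fun x ↦ (bdryValue_eq_of_eqOn_of_continuousAt hq (continuousAt_sum_q s w c hw (by simp))).2
  have hbv_fun : bdryValue (fun z ↦ (∑ i ∈ s, c i * kernel W (w i) z) / W z) = fun x : ℝ ↦ R x :=
    funext hbv
  refine ⟨?_, ?_, ?_, ?_, ?_⟩
  · -- analytic
    refine DifferentiableOn.fun_sum fun i hi ↦ ?_
    exact (differentiableOn_const (c i)).mul (differentiableOn_kernel hW (hw i hi))
  · -- bounded type over `1`
    refine ⟨R, fun _ ↦ 1, ?_, differentiableOn_const _,
      ⟨∑ i ∈ s, ‖c i * conj (W (w i))‖ / (2 * π * (w i).im), fun z hz ↦ ?_⟩,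
      ⟨1, fun z _ ↦ by simp⟩, fun z _ ↦ one_ne_zero, fun z hz ↦ by rw [div_one]; exact hq z hz⟩
    · refine DifferentiableOn.fun_sum fun i hi ↦ ?_
      intro z hz
      have hz' : 0 < z.im := hz
      have h1 : DifferentiableAt ℂ (fun _ : ℂ ↦ c i * conj (W (w i))) z := differentiableAt_const _
      have h2 : DifferentiableAt ℂ (fun u : ℂ ↦ 2 * (π : ℂ) * I * (conj (w i) - u)) z := by
        fun_prop
      exact (h1.div h2 (den_ne_zero' (hw i hi) hz'.le)).differentiableWithinAt
    · exact (norm_sum_le _ _).trans (Finset.sum_le_sum fun i hi ↦ norm_q_le' (hw i hi) _ hz.le)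
  · -- boundary values exist (everywhere)
    exact ae_of_all _ fun x ↦ by
      rw [hbv x]
      exact (bdryValue_eq_of_eqOn_of_continuousAt hq (continuousAt_sum_q s w c hw (by simp))).1
  · -- `L²` boundary function
    rw [hbv_fun]
    exact memLp_sum_q s w c hw
  · -- Poisson log-majorant
    intro x y hy
    have h := poissonLogMajorant_sum_q (W := W) s w c hw x hy
    rw [hbv_fun]
    refine ⟨h.1, fun hne ↦ ?_⟩
    have hzpt : 0 < ((x : ℂ) + y * I).im := by simpa using hy
    have hq' := hq _ hzpt
    change (∑ i ∈ s, c i * kernel W (w i) ((x : ℂ) + y * I)) / W ((x : ℂ) + y * I) ≠ 0 at hne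
    change Real.log ‖(∑ i ∈ s, c i * kernel W (w i) ((x : ℂ) + y * I)) / W ((x : ℂ) + y * I)‖ ≤ _
    rw [hq'] at hne ⊢
    exact h.2 hne

end SpaceF

namespace SpaceF

variable {W : ℂ → ℂ}

/-! ## §3. `T` on finite combinations and the scalar products `⟨F, TF⟩` -/

/-- **`TF = Σ c_β K(w_β + i, ·)` for `F = Σ c_α K(w_α, ·)`** ("If `F(z) = Σ c_α K(w_α, z)`, then
`TF(z) = Σ c_β K(w_β + i, z)`"), on the open upper half-plane, by the additivity and homogeneity of
the kernel shift `T` on members of `𝓕(W)`. [cite: ConreyLi2000, proof of Theorem 2 (first display)] -/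
theorem kernelShift_sum (hW : DifferentiableOn ℂ W {z : ℂ | 0 < z.im})
    (hW0 : ∀ z : ℂ, 0 < z.im → W z ≠ 0) {T : (ℂ → ℂ) → (ℂ → ℂ)} (hT : IsKernelShift W T)
    {ι : Type*} (s : Finset ι) (w c : ι → ℂ) (hw : ∀ i ∈ s, 0 < (w i).im) :
    Set.EqOn (T (fun z ↦ ∑ i ∈ s, c i * kernel W (w i) z))
      (fun z ↦ ∑ i ∈ s, c i * kernel W (w i + I) z) {z : ℂ | 0 < z.im} := by
  classical
  induction s using Finset.induction_on with
  | empty =>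
    intro z hz
    have hI : (0 : ℝ) < (I : ℂ).im := by simp
    have h0 : (fun z : ℂ ↦ ∑ i ∈ (∅ : Finset ι), c i * kernel W (w i) z) = (0 : ℂ) • kernel W I := by
      funext u; simp
    rw [h0]
    have h := hT.map_smul 0 (kernel W I) (kernel_mem hW hW0 hI) hz
    rw [h]
    simp
  | insert a s ha ih =>
    intro z hz
    have hwa : 0 < (w a).im := hw a (Finset.mem_insert_self a s)
    have hws : ∀ i ∈ s, 0 < (w i).im := fun i hi ↦ hw i (Finset.mem_insert_of_mem hi)
    -- split off the first kernel
    have hsplit : (fun z : ℂ ↦ ∑ i ∈ insert a s, c i * kernel W (w i) z)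
        = (c a • kernel W (w a)) + fun z ↦ ∑ i ∈ s, c i * kernel W (w i) z := by
      funext u
      simp only [Finset.sum_insert ha, Pi.add_apply, Pi.smul_apply, smul_eq_mul]
    have hmem₁ : Mem W (c a • kernel W (w a)) := by
      have h := sum_kernel_mem hW hW0 ({a} : Finset ι) w c (fun i hi ↦ by
        rw [Finset.mem_singleton] at hi; rw [hi]; exact hwa)
      have he : (fun z : ℂ ↦ ∑ i ∈ ({a} : Finset ι), c i * kernel W (w i) z) = c a • kernel W (w a) := by
        funext u; simp [Finset.sum_singleton]
      rwa [he] at h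
    have hmem₂ : Mem W (fun z ↦ ∑ i ∈ s, c i * kernel W (w i) z) := sum_kernel_mem hW hW0 s w c hws
    rw [hsplit, hT.map_add _ _ hmem₁ hmem₂ hz, Pi.add_apply,
      hT.map_smul (c a) (kernel W (w a)) (kernel_mem hW hW0 hwa) hz, Pi.smul_apply,
      hT.map_kernel (w a) hwa hz, ih hws hz, smul_eq_mul]
    simp only [Finset.sum_insert ha]

/-- `∫_ℝ dx/((x − w̄)(x − v)) = 2πi/(v − w̄)` for `Im w > 0`, `Im v > 0` (the tree's half-plane Cauchy
formula `integral_div_sub_eq_of_im_pos` for `g = 1/(· − w̄)`). [folklore] -/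
private theorem integral_inv_mul_inv' {w : ℂ} (hw : 0 < w.im) {v : ℂ} (hv : 0 < v.im) :
    ∫ x : ℝ, ((x : ℂ) - conj w)⁻¹ / ((x : ℂ) - v) = 2 * π * I * (v - conj w)⁻¹ := by
  set m : ℝ := w.im with hm
  have hcw : ∀ z : ℂ, 0 ≤ z.im → z - conj w ≠ 0 := by
    intro z hz h
    have := congrArg Complex.im h
    simp only [sub_im, conj_im, zero_im] at this
    linarith
  have hd : ∀ z : ℂ, 0 ≤ z.im → DifferentiableAt ℂ (fun z : ℂ ↦ (z - conj w)⁻¹) z :=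
    fun z hz ↦ (differentiableAt_id.sub_const _).inv (hcw z hz)
  have hi : Integrable fun x : ℝ ↦ ‖((x : ℂ) - conj w)⁻¹‖ ^ 2 :=
    integrable_norm_inv_ofReal_sub_sq (w := conj w) (by rw [conj_im]; linarith)
  set K : ℝ := max 1 m⁻¹ with hK
  have hb : ∀ z : ℂ, 0 < z.im → (0 : ℝ) ≤ ‖z‖ → ‖(z - conj w)⁻¹‖ ≤ K / Real.sqrt z.im := by
    intro z hz _
    have hzw : m ≤ ‖z - conj w‖ := by
      have h := Complex.abs_im_le_norm (z - conj w)
      have h2 : (z - conj w).im = z.im + m := by simp [hm]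
      rw [h2, abs_of_pos (by linarith)] at h
      linarith
    have hzw' : z.im ≤ ‖z - conj w‖ := by
      have h := Complex.abs_im_le_norm (z - conj w)
      have h2 : (z - conj w).im = z.im + m := by simp [hm]
      rw [h2, abs_of_pos (by linarith)] at h
      linarith
    have hpos : 0 < ‖z - conj w‖ := hw.trans_le hzw
    have hsqrt : Real.sqrt z.im ≤ K * ‖z - conj w‖ := by
      rcases le_or_gt 1 z.im with h1 | h1
      · have hs : Real.sqrt z.im ≤ z.im := by
          rw [Real.sqrt_le_left (by linarith)]; nlinarith
        calc Real.sqrt z.im ≤ ‖z - conj w‖ := hs.trans hzw'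
          _ ≤ K * ‖z - conj w‖ := le_mul_of_one_le_left (norm_nonneg _) (le_max_left _ _)
      · have hs : Real.sqrt z.im ≤ 1 := by rw [Real.sqrt_le_one]; exact h1.le
        calc Real.sqrt z.im ≤ 1 := hs
          _ ≤ m⁻¹ * ‖z - conj w‖ := by rw [le_inv_mul_iff₀ hw]; simpa using hzw
          _ ≤ K * ‖z - conj w‖ := mul_le_mul_of_nonneg_right (le_max_right _ _) (norm_nonneg _)
    rw [norm_inv, inv_le_comm₀ hpos (by positivity), inv_div]
    rw [div_le_iff₀ (lt_of_lt_of_le zero_lt_one (le_max_left _ _))]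
    linarith
  have hK0 : (0 : ℝ) ≤ K := le_trans zero_le_one (le_max_left _ _)
  have h := integral_div_sub_eq_of_im_pos (R₀ := 0) hK0 hd hi hb hv
  simpa using h

/-- The product of two boundary kernels: for real `x`,
`[c₁/(2πi(ā − x))] · conj[c₂/(2πi(v̄ − x))] = (c₁ c̄₂/(4π²)) · (x − ā)⁻¹/(x − v)`. [folklore] -/
private theorem q_mul_conj_q (a v c₁ c₂ : ℂ) (x : ℝ) (ha : (x : ℂ) - conj a ≠ 0) (hv : (x : ℂ) - v ≠ 0) :
    c₁ / (2 * π * I * (conj a - x)) * conj (c₂ / (2 * π * I * (conj v - x)))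
      = c₁ * conj c₂ / (4 * π ^ 2) * (((x : ℂ) - conj a)⁻¹ / ((x : ℂ) - v)) := by
  have hπ : (π : ℂ) ≠ 0 := ofReal_ne_zero.2 Real.pi_ne_zero
  have e1 : conj (c₂ / (2 * π * I * (conj v - x))) = conj c₂ / (-(2 * π * I) * (v - x)) := by
    simp only [map_div₀, map_mul, map_sub, Complex.conj_conj, Complex.conj_ofReal, Complex.conj_I,
      map_ofNat]
    ring
  have ha' : conj a - (x : ℂ) ≠ 0 := fun h ↦ ha (by rw [← neg_sub, h, neg_zero])
  have hv' : v - (x : ℂ) ≠ 0 := fun h ↦ hv (by rw [← neg_sub, h, neg_zero])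
  rw [e1]
  field_simp
  ring_nf
  rw [Complex.I_sq]
  ring

/-- Integrability of the product of two boundary kernels on `ℝ`. [folklore] -/
private theorem integrable_q_mul_conj_q {a v : ℂ} (ha : 0 < a.im) (hv : 0 < v.im) (c₁ c₂ : ℂ) :
    Integrable fun x : ℝ ↦ c₁ / (2 * π * I * (conj a - x)) * conj (c₂ / (2 * π * I * (conj v - x))) := by
  have hxa : ∀ x : ℝ, (x : ℂ) - conj a ≠ 0 := by
    intro x h
    have := congrArg Complex.im h; simp at this; linarith
  have hxv : ∀ x : ℝ, (x : ℂ) - v ≠ 0 := by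
    intro x h
    have := congrArg Complex.im h; simp at this; linarith
  have h1 : Integrable fun x : ℝ ↦ ((x : ℂ) - conj a)⁻¹ / ((x : ℂ) - v) := by
    refine integrable_div_ofReal_sub ?_ ?_ (w := v) hv.ne'
    · exact ((Complex.continuous_ofReal.sub continuous_const).inv₀ hxa).aestronglyMeasurable
    · exact integrable_norm_inv_ofReal_sub_sq (w := conj a) (by rw [conj_im]; linarith)
  refine (h1.const_mul (c₁ * conj c₂ / (4 * π ^ 2))).congr (ae_of_all _ fun x ↦ ?_)
  simp only
  rw [q_mul_conj_q a v c₁ c₂ x (hxa x) (hxv x)]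

/-- `∫_ℝ [c₁/(2πi(ā − x))]·conj[c₂/(2πi(v̄ − x))] dx = c₁ c̄₂/(2πi(ā − v))` for `Im a, Im v > 0`
(Cauchy's formula along `ℝ`; with `v = b + i` this is the entry `⟨c₁K(a,·), c₂K(b+i,·)⟩ = c₁c̄₂K(a, b+i)`
up to the factors `W`). [cite: ConreyLi2000, §2 (2.6) and the proof of Theorem 2] -/
private theorem integral_q_mul_conj_q {a v : ℂ} (ha : 0 < a.im) (hv : 0 < v.im) (c₁ c₂ : ℂ) :
    ∫ x : ℝ, c₁ / (2 * π * I * (conj a - x)) * conj (c₂ / (2 * π * I * (conj v - x)))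
      = c₁ * conj c₂ / (2 * π * I * (conj a - v)) := by
  have hxa : ∀ x : ℝ, (x : ℂ) - conj a ≠ 0 := by
    intro x h
    have := congrArg Complex.im h; simp at this; linarith
  have hxv : ∀ x : ℝ, (x : ℂ) - v ≠ 0 := by
    intro x h
    have := congrArg Complex.im h; simp at this; linarith
  have hpt : ∀ x : ℝ, c₁ / (2 * π * I * (conj a - x)) * conj (c₂ / (2 * π * I * (conj v - x)))
      = c₁ * conj c₂ / (4 * π ^ 2) * (((x : ℂ) - conj a)⁻¹ / ((x : ℂ) - v)) :=
    fun x ↦ q_mul_conj_q a v c₁ c₂ x (hxa x) (hxv x)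
  simp_rw [hpt]
  rw [integral_const_mul, integral_inv_mul_inv' ha hv]
  have hπ : (π : ℂ) ≠ 0 := ofReal_ne_zero.2 Real.pi_ne_zero
  have hav : v - conj a ≠ 0 := by
    intro h
    have := congrArg Complex.im h; simp at this; linarith
  have hav' : conj a - v ≠ 0 := fun h ↦ hav (by rw [← neg_sub, h, neg_zero])
  field_simp
  ring_nf
  rw [Complex.I_sq]
  ring

/-- **`⟨F, TF⟩_{𝓕(W)} = Σ_α Σ_β c_α c̄_β K(w_α, w_β + i)`** for `F = Σ c_α K(w_α, ·)` — the identity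
behind the printed "`Σ c_α c̄_β [K(w_α, w_β+i) + K(w_α+i, w_β)] = 2Re⟨F, TF⟩`": the boundary functions
of `F/W` and `TF/W` are `Σ c_α conj W(w_α)/(2πi(w̄_α − x))` and `Σ c_β conj W(w_β+i)/(2πi(w̄_β − i − x))`,
and each pair integrates by Cauchy's formula along `ℝ`.
[cite: ConreyLi2000, proof of Theorem 2 (first display) and (2.6)] -/
theorem inner_sum_kernel_kernelShift (hW : DifferentiableOn ℂ W {z : ℂ | 0 < z.im})
    (hW0 : ∀ z : ℂ, 0 < z.im → W z ≠ 0) {T : (ℂ → ℂ) → (ℂ → ℂ)} (hT : IsKernelShift W T)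
    {ι : Type*} (s : Finset ι) (w c : ι → ℂ) (hw : ∀ i ∈ s, 0 < (w i).im) :
    inner W (fun z ↦ ∑ i ∈ s, c i * kernel W (w i) z) (T (fun z ↦ ∑ i ∈ s, c i * kernel W (w i) z))
      = ∑ i ∈ s, ∑ j ∈ s, c i * conj (c j) * kernel W (w i) (w j + I) := by
  have hwI : ∀ i ∈ s, 0 < (w i + I).im := fun i hi ↦ by simp; linarith [hw i hi]
  -- boundary functions
  set R : ℂ → ℂ := fun u ↦ ∑ i ∈ s, c i * conj (W (w i)) / (2 * π * I * (conj (w i) - u)) with hR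
  set Rs : ℂ → ℂ := fun u ↦ ∑ i ∈ s, c i * conj (W (w i + I)) / (2 * π * I * (conj (w i + I) - u))
    with hRs
  have hq : ∀ z : ℂ, 0 < z.im → (∑ i ∈ s, c i * kernel W (w i) z) / W z = R z :=
    fun z hz ↦ sum_kernel_div s w c (hW0 z hz)
  have hqs : ∀ z : ℂ, 0 < z.im →
      T (fun z ↦ ∑ i ∈ s, c i * kernel W (w i) z) z / W z = Rs z := by
    intro z hz
    rw [kernelShift_sum hW hW0 hT s w c hw hz]
    exact sum_kernel_div s (fun i ↦ w i + I) c (hW0 z hz)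
  have hbv : bdryValue (fun z ↦ (∑ i ∈ s, c i * kernel W (w i) z) / W z) = fun x : ℝ ↦ R x :=
    funext fun x ↦ (bdryValue_eq_of_eqOn_of_continuousAt hq
      (continuousAt_sum_q s w c hw (by simp))).2
  have hbvs : bdryValue (fun z ↦ T (fun z ↦ ∑ i ∈ s, c i * kernel W (w i) z) z / W z)
      = fun x : ℝ ↦ Rs x :=
    funext fun x ↦ (bdryValue_eq_of_eqOn_of_continuousAt hqs
      (continuousAt_sum_q s (fun i ↦ w i + I) c hwI (by simp))).2
  unfold inner
  rw [hbv, hbvs]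
  -- expand the product of sums
  have hprod : ∀ x : ℝ, R x * conj (Rs x) = ∑ i ∈ s, ∑ j ∈ s,
      c i * conj (W (w i)) / (2 * π * I * (conj (w i) - x)) *
        conj (c j * conj (W (w j + I)) / (2 * π * I * (conj (w j + I) - x))) := by
    intro x
    simp only [hR, hRs]
    rw [map_sum, Finset.sum_mul_sum]
  simp_rw [hprod]
  rw [integral_finsetSum s fun i hi ↦ integrable_finsetSum s fun j hj ↦
    integrable_q_mul_conj_q (hw i hi) (hwI j hj) _ _]
  refine Finset.sum_congr rfl fun i hi ↦ ?_
  rw [integral_finsetSum s fun j hj ↦ integrable_q_mul_conj_q (hw i hi) (hwI j hj) _ _]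
  refine Finset.sum_congr rfl fun j hj ↦ ?_
  rw [integral_q_mul_conj_q (hw i hi) (hwI j hj)]
  unfold kernel
  simp only [map_mul, Complex.conj_conj]
  have hden : 2 * (π : ℂ) * I * (conj (w i) - (w j + I)) ≠ 0 := den_ne_zero' (hw i hi) (hwI j hj).le
  field_simp

/-- **The positive-definiteness extracted from the hypothesis of Theorem 2** ("By assumption, we
have `Σ c_α c̄_β [K(w_α, w_β+i) + K(w_α+i, w_β)] = 2Re⟨F, TF⟩ ≥ 0`, that is, the expression
`K(w+i, z) + K(w, z+i)` is positive-definite for `w, z` in the upper half-plane").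
[cite: ConreyLi2000, proof of Theorem 2] -/
theorem re_sum_kernel_add_kernel_nonneg (hW : DifferentiableOn ℂ W {z : ℂ | 0 < z.im})
    (hW0 : ∀ z : ℂ, 0 < z.im → W z ≠ 0) {T : (ℂ → ℂ) → (ℂ → ℂ)} (hT : IsKernelShift W T)
    (hpos : ∀ F : ℂ → ℂ, Mem W F → 0 ≤ (inner W F (T F)).re)
    {ι : Type*} (s : Finset ι) (w c : ι → ℂ) (hw : ∀ i ∈ s, 0 < (w i).im) :
    0 ≤ (∑ i ∈ s, ∑ j ∈ s,
      c i * conj (c j) * (kernel W (w i) (w j + I) + kernel W (w i + I) (w j))).re := by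
  set S : ℂ := inner W (fun z ↦ ∑ i ∈ s, c i * kernel W (w i) z)
    (T (fun z ↦ ∑ i ∈ s, c i * kernel W (w i) z)) with hS
  have hS' : S = ∑ i ∈ s, ∑ j ∈ s, c i * conj (c j) * kernel W (w i) (w j + I) :=
    inner_sum_kernel_kernelShift hW hW0 hT s w c hw
  have hSre : 0 ≤ S.re := hpos _ (sum_kernel_mem hW hW0 s w c hw)
  have hconjS : conj S = ∑ i ∈ s, ∑ j ∈ s, c i * conj (c j) * kernel W (w i + I) (w j) := by
    rw [hS', map_sum, Finset.sum_comm]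
    refine Finset.sum_congr rfl fun i _ ↦ ?_
    rw [map_sum]
    refine Finset.sum_congr rfl fun j _ ↦ ?_
    rw [map_mul, map_mul, Complex.conj_conj, conj_kernel]
    ring
  have htot : ∑ i ∈ s, ∑ j ∈ s, c i * conj (c j) * (kernel W (w i) (w j + I) + kernel W (w i + I) (w j))
      = S + conj S := by
    rw [hconjS, hS', ← Finset.sum_add_distrib]
    refine Finset.sum_congr rfl fun i _ ↦ ?_
    rw [← Finset.sum_add_distrib]
    refine Finset.sum_congr rfl fun j _ ↦ ?_
    ring
  rw [htot, Complex.add_re, Complex.conj_re]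
  linarith

/-! ## §4. The Cayley transform and the discharge of Theorem 2 -/

/-- On the upper half-plane `W(z) + W(z+i) ≠ 0` under the hypotheses of Theorem 2
(since `Re W(z)/W(z+i) ≥ 0`). [cite: ConreyLi2000, proof of Theorem 2] -/
theorem add_shift_ne_zero (hW : DifferentiableOn ℂ W {z : ℂ | 0 < z.im})
    (hW0 : ∀ z : ℂ, 0 < z.im → W z ≠ 0) {T : (ℂ → ℂ) → (ℂ → ℂ)} (hT : IsKernelShift W T)
    (hpos : ∀ F : ℂ → ℂ, Mem W F → 0 ≤ (inner W F (T F)).re) {z : ℂ} (hz : 0 < z.im) :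
    W z + W (z + I) ≠ 0 := by
  intro h
  have hre := conreyLi2000_thm2_upperHalfPlane hW hW0 hT hpos hz
  have hzI : 0 < (z + I).im := by simp; linarith
  have hq : W z / W (z + I) = -1 := by
    rw [div_eq_iff (hW0 _ hzI), eq_neg_of_add_eq_zero_left h]; ring
  rw [hq] at hre
  norm_num at hre

/-- **The Cayley transform `B = (W − W(·+i))/(W + W(·+i))` satisfies the Schur-kernel positivity**
("The positive-definiteness of `K(w+i, z) + K(w, z+i)` implies the positive-definiteness of the
expression `(1 − B(z)B̄(w))/(2πi(w̄ − z − i))` for `w, z` in the upper half-plane"): for all finite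
families `wᵢ` (`Im wᵢ > 0`) and coefficients `cᵢ`,
`Re Σᵢⱼ c̄ᵢ cⱼ (1 − B(wᵢ)B̄(wⱼ))/(2πi(w̄ⱼ − wᵢ − i)) ≥ 0`. Algebra: with `dᵢ = cᵢ/conj(W(wᵢ) + W(wᵢ+i))`,
the sum is the conjugate of `2 Σ dᵢ d̄ⱼ [K(wᵢ, wⱼ+i) + K(wᵢ+i, wⱼ)]`.
[cite: ConreyLi2000, proof of Theorem 2] -/
theorem re_sum_cayley_nonneg (hW : DifferentiableOn ℂ W {z : ℂ | 0 < z.im})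
    (hW0 : ∀ z : ℂ, 0 < z.im → W z ≠ 0) {T : (ℂ → ℂ) → (ℂ → ℂ)} (hT : IsKernelShift W T)
    (hpos : ∀ F : ℂ → ℂ, Mem W F → 0 ≤ (inner W F (T F)).re)
    {ι : Type*} (s : Finset ι) (w c : ι → ℂ) (hw : ∀ i ∈ s, 0 < (w i).im) :
    0 ≤ (∑ i ∈ s, ∑ j ∈ s, conj (c i) * c j *
      (1 - (W (w i) - W (w i + I)) / (W (w i) + W (w i + I)) *
        conj ((W (w j) - W (w j + I)) / (W (w j) + W (w j + I)))) /
      (2 * π * I * (conj (w j) - w i - I))).re := by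
  set d : ι → ℂ := fun i ↦ c i / conj (W (w i) + W (w i + I)) with hd
  have h := re_sum_kernel_add_kernel_nonneg hW hW0 hT hpos s w d hw
  have hsum : ∀ i ∈ s, W (w i) + W (w i + I) ≠ 0 := fun i hi ↦ add_shift_ne_zero hW hW0 hT hpos (hw i hi)
  have hwI : ∀ i ∈ s, 0 < (w i + I).im := fun i hi ↦ by simp; linarith [hw i hi]
  have hterm : ∀ i ∈ s, ∀ j ∈ s,
      conj (c i) * c j * (1 - (W (w i) - W (w i + I)) / (W (w i) + W (w i + I)) *
        conj ((W (w j) - W (w j + I)) / (W (w j) + W (w j + I)))) / (2 * π * I * (conj (w j) - w i - I))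
      = conj (2 * (d i * conj (d j) * (kernel W (w i) (w j + I) + kernel W (w i + I) (w j)))) := by
    intro i hi j hj
    have h1 : W (w i) + W (w i + I) ≠ 0 := hsum i hi
    have h2 : W (w j) + W (w j + I) ≠ 0 := hsum j hj
    have h1' : conj (W (w i) + W (w i + I)) ≠ 0 := by
      rwa [Ne, map_eq_zero_iff _ (RingHom.injective _)]
    have h2' : conj (W (w j) + W (w j + I)) ≠ 0 := by
      rwa [Ne, map_eq_zero_iff _ (RingHom.injective _)]
    have h3 : conj (w j) - w i - I ≠ 0 := by
      intro h0
      have := congrArg Complex.im h0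
      simp only [sub_im, conj_im, I_im, zero_im] at this
      linarith [hw i hi, hw j hj]
    have h4 : conj (w i) - (w j + I) ≠ 0 := by
      intro h0
      have := congrArg Complex.im h0
      simp only [sub_im, add_im, conj_im, I_im, zero_im] at this
      linarith [hw i hi, hw j hj]
    have h5 : conj (w i + I) - w j ≠ 0 := by
      intro h0
      have := congrArg Complex.im h0
      simp only [sub_im, map_add, add_im, conj_im, Complex.conj_I, neg_im, I_im, zero_im] at this
      linarith [hw i hi, hw j hj]
    have hπ : (π : ℂ) ≠ 0 := ofReal_ne_zero.2 Real.pi_ne_zero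
    -- abbreviations
    set u : ℂ := W (w i) with hu
    set u' : ℂ := W (w i + I) with hu'
    set v : ℂ := W (w j) with hv
    set v' : ℂ := W (w j + I) with hv'
    set E : ℂ := 2 * π * I * (conj (w i) - w j - I) with hE
    have hE0 : E ≠ 0 := by
      rw [hE]
      refine mul_ne_zero (mul_ne_zero (mul_ne_zero two_ne_zero hπ) I_ne_zero) ?_
      intro h0
      have := congrArg Complex.im h0
      simp only [sub_im, conj_im, I_im, zero_im] at this
      linarith [hw i hi, hw j hj]
    have hE0' : conj E ≠ 0 := by rwa [Ne, map_eq_zero_iff _ (RingHom.injective _)]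
    -- the two kernels have the common denominator `E`
    have hK : kernel W (w i) (w j + I) + kernel W (w i + I) (w j) = (v' * conj u + v * conj u') / E := by
      simp only [kernel, map_add, Complex.conj_I]
      rw [show 2 * (π : ℂ) * I * (conj (w i) - (w j + I)) = E by rw [hE]; ring,
        show 2 * (π : ℂ) * I * (conj (w i) + -I - w j) = E by rw [hE]; ring, ← add_div]
    -- the Cayley numerator
    have hBB : 1 - (u - u') / (u + u') * conj ((v - v') / (v + v'))
        = 2 * (u * conj v' + u' * conj v) / ((u + u') * conj (v + v')) := by
      rw [map_div₀, map_sub, map_add]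
      have h2'' : conj v + conj v' ≠ 0 := by rwa [← map_add]
      field_simp
      ring
    -- the target denominator is `conj E`
    have hDE : 2 * (π : ℂ) * I * (conj (w j) - w i - I) = conj E := by
      simp only [hE, map_mul, map_sub, map_ofNat, Complex.conj_ofReal, Complex.conj_I,
        Complex.conj_conj]
      ring
    rw [hBB, hDE, hK]
    simp only [hd, map_mul, map_div₀, map_add, map_ofNat, Complex.conj_conj]
    rw [← hu, ← hu', ← hv, ← hv']
    field_simp
  rw [Finset.sum_congr rfl fun i hi ↦ Finset.sum_congr rfl fun j hj ↦ hterm i hi j hj]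
  simp_rw [← map_sum]
  rw [Complex.conj_re]
  simp_rw [← Finset.mul_sum]
  rw [show (2 : ℂ) = ((2 : ℝ) : ℂ) by norm_num, Complex.re_ofReal_mul]
  exact mul_nonneg zero_le_two h

end SpaceF

/-- **Conrey–Li 2000, Theorem 2 (de Branges' positivity theorem for `𝓕(W)`) — PROVED**, discharging
the named fact `conreyLi2000_thm2`: for `W` analytic and zero-free on the open upper half-plane and
`T` a linear transformation of `𝓕(W)` into itself taking `K(w, ·)` to `K(w + i, ·)` (`Im w > 0`),
if `Re⟨F, TF⟩_{𝓕(W)} ≥ 0` for every `F ∈ 𝓕(W)`, then `W` has an analytic extension `W₁` to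
`Im z > −1/2` and `Re W₁(z)/W₁(z+i) ≥ 0` there. Proof = the printed one: positivity on finite
kernel combinations (`SpaceF.re_sum_kernel_add_kernel_nonneg`), Cayley transform
`B = (W − W(·+i))/(W + W(·+i))` (`SpaceF.re_sum_cayley_nonneg`), the contraction/adjoint step
(2.7)–(2.8) (`SzegoSchur.szego_schur_extension`) giving `B₁` with `|B₁| ≤ 1` on `Im z > −1/2`,
`B₁ ≠ 1` by the maximum modulus principle, and `W₁(z) := W(z+i)(1 + B₁(z))/(1 − B₁(z))`, for which
`W₁ = W` on `Im z > 0` and `Re W₁(z)/W₁(z+i) = Re(1 + B₁)/(1 − B₁) = (1 − |B₁|²)/|1 − B₁|² ≥ 0`.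
[cite: ConreyLi2000, Theorem 2] -/
theorem conreyLi2000_thm2_holds : conreyLi2000_thm2 := by
  intro W hW hW0 T hT hpos
  -- the Cayley transform and its Schur extension
  set B : ℂ → ℂ := fun z ↦ (W z - W (z + I)) / (W z + W (z + I)) with hB
  have hpsd : ∀ (ι : Type) (s : Finset ι) (w : ι → ℂ) (c : ι → ℂ), (∀ i ∈ s, 0 < (w i).im) →
      0 ≤ (∑ i ∈ s, ∑ j ∈ s, conj (c i) * c j * (1 - B (w i) * conj (B (w j))) /
        (2 * π * I * (conj (w j) - w i - I))).re :=
    fun ι s w c hw ↦ SpaceF.re_sum_cayley_nonneg hW hW0 hT hpos s w c hw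
  obtain ⟨B₁, hB₁d, hB₁eq, hB₁le⟩ := SzegoSchur.szego_schur_extension hpsd
  have hsum : ∀ z : ℂ, 0 < z.im → W z + W (z + I) ≠ 0 :=
    fun z hz ↦ SpaceF.add_shift_ne_zero hW hW0 hT hpos hz
  have hIm : ∀ z : ℂ, 0 < z.im → 0 < (z + I).im := fun z hz ↦ by simp; linarith
  -- `B ≠ 1` on the upper half-plane, hence `B₁ ≠ 1` on `Im z > −1/2` (maximum modulus)
  have hBne : ∀ z : ℂ, 0 < z.im → B z ≠ 1 := by
    intro z hz h1
    have h1' : (W z - W (z + I)) / (W z + W (z + I)) = 1 := h1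
    rw [div_eq_one_iff_eq (hsum z hz)] at h1'
    have : W (z + I) = 0 := by linear_combination (-1 / 2 : ℂ) * h1'
    exact hW0 _ (hIm z hz) this
  have hopen : IsOpen {z : ℂ | -1 / 2 < z.im} := isOpen_lt continuous_const Complex.continuous_im
  have hconn : IsPreconnected {z : ℂ | -1 / 2 < z.im} :=
    (convex_halfSpace_im_gt (-1 / 2)).isPreconnected
  have hI : (0 : ℝ) < (I : ℂ).im := by simp
  have hI' : (I : ℂ) ∈ {z : ℂ | -1 / 2 < z.im} := by
    change (-1 / 2 : ℝ) < (I : ℂ).im; simp; norm_num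
  have hB₁ne : ∀ z : ℂ, -1 / 2 < z.im → B₁ z ≠ 1 := by
    intro z hz h1
    have hmax : IsMaxOn (norm ∘ B₁) {z : ℂ | -1 / 2 < z.im} z := by
      intro u hu
      change ‖B₁ u‖ ≤ ‖B₁ z‖
      rw [h1, norm_one]
      exact hB₁le u hu
    have heq := Complex.eqOn_of_isPreconnected_of_isMaxOn_norm hconn hopen hB₁d hz hmax hI'
    change B₁ I = B₁ z at heq
    rw [h1, hB₁eq hI] at heq
    exact hBne I hI heq
  -- the extension `W₁`
  refine ⟨fun z ↦ W (z + I) * (1 + B₁ z) / (1 - B₁ z), ?_, ?_, ?_⟩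
  · -- analytic on `Im z > −1/2`
    have hshift : DifferentiableOn ℂ (fun z : ℂ ↦ W (z + I)) {z : ℂ | -1 / 2 < z.im} := by
      refine hW.comp (by fun_prop) fun z hz ↦ ?_
      change 0 < (z + I).im
      have : (-1 / 2 : ℝ) < z.im := hz
      simp; linarith
    refine (hshift.mul ((differentiableOn_const 1).add hB₁d)).div
      ((differentiableOn_const 1).sub hB₁d) fun z hz ↦ ?_
    exact sub_ne_zero.2 (Ne.symm (hB₁ne z hz))
  · -- `W₁ = W` on the upper half-plane
    intro z hz
    have hz' : 0 < z.im := hz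
    change W (z + I) * (1 + B₁ z) / (1 - B₁ z) = W z
    rw [hB₁eq hz]
    change W (z + I) * (1 + (W z - W (z + I)) / (W z + W (z + I)))
      / (1 - (W z - W (z + I)) / (W z + W (z + I))) = W z
    have h1 := hsum z hz'
    have h2 := hW0 _ (hIm z hz')
    have e1 : 1 + (W z - W (z + I)) / (W z + W (z + I)) = 2 * W z / (W z + W (z + I)) := by
      field_simp; ring
    have e2 : 1 - (W z - W (z + I)) / (W z + W (z + I)) = 2 * W (z + I) / (W z + W (z + I)) := by
      field_simp; ring
    rw [e1, e2]
    field_simp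
  · -- `Re W₁(z)/W₁(z+i) ≥ 0`
    intro z hz
    have hzI : 0 < (z + I).im := by simp; linarith
    -- `W₁(z + i) = W(z + i)` because `z + i` lies in the upper half-plane
    have hup : W (z + I + I) * (1 + B₁ (z + I)) / (1 - B₁ (z + I)) = W (z + I) := by
      rw [hB₁eq hzI]
      change W (z + I + I) * (1 + (W (z + I) - W (z + I + I)) / (W (z + I) + W (z + I + I)))
        / (1 - (W (z + I) - W (z + I + I)) / (W (z + I) + W (z + I + I))) = W (z + I)
      have h1 := hsum (z + I) hzI
      have h2 := hW0 _ (hIm (z + I) hzI)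
      have e1 : 1 + (W (z + I) - W (z + I + I)) / (W (z + I) + W (z + I + I))
          = 2 * W (z + I) / (W (z + I) + W (z + I + I)) := by
        field_simp; ring
      have e2 : 1 - (W (z + I) - W (z + I + I)) / (W (z + I) + W (z + I + I))
          = 2 * W (z + I + I) / (W (z + I) + W (z + I + I)) := by
        field_simp; ring
      rw [e1, e2]
      field_simp
    change 0 ≤ ((W (z + I) * (1 + B₁ z) / (1 - B₁ z)) /
      (W (z + I + I) * (1 + B₁ (z + I)) / (1 - B₁ (z + I)))).re
    rw [hup]
    have hWzI : W (z + I) ≠ 0 := hW0 _ hzI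
    have hb1 : 1 - B₁ z ≠ 0 := sub_ne_zero.2 (Ne.symm (hB₁ne z hz))
    have hratio : W (z + I) * (1 + B₁ z) / (1 - B₁ z) / W (z + I) = (1 + B₁ z) / (1 - B₁ z) := by
      field_simp
    rw [hratio]
    -- `Re (1 + b)/(1 − b) = (1 − |b|²)/|1 − b|² ≥ 0`
    set b : ℂ := B₁ z with hb
    have hble : ‖b‖ ≤ 1 := hB₁le z hz
    have hns : 0 < Complex.normSq (1 - b) := Complex.normSq_pos.2 hb1
    rw [Complex.div_re]
    have hnum : (1 + b).re * (1 - b).re + (1 + b).im * (1 - b).im = 1 - Complex.normSq b := by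
      rw [Complex.normSq_apply]; simp; ring
    rw [← add_div, hnum]
    refine div_nonneg ?_ hns.le
    rw [Complex.normSq_eq_norm_sq]
    nlinarith [norm_nonneg b]

end Literature.Analysis.DeBrangesSpaces

end
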